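import Summits.RiemannHypothesis.RiemannHypothesis.Theorems.PfPersistenceF3SharpLocalDatum

/-!
# F3 — FE-honest twins `ζ·(1 + b p^{-s} + p^{1-2s})` — PARITY RULE for the F3-A test function — pub-rhpf fake-3

HONEST FRAMING: mechanism/rigidity campaign; no RH claims.  The observatory serves the Weil form of a
datum in two Galerkin blocks, EVEN and ODD test functions.  DATA (HOME/pub-rhpf-fake-3/ONSETS.md, 31/31
certified onsets): for `F_{p,b}` with `|b| > 2√p` the ODD block fails first when `b < 0` and the EVEN block
when `b > 0`.  The kernel fact behind it: for an EVEN one-window test `g₁` (e.g. `ζ`'s even ground state)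
the F3-A twin `sharpTwinTest p b g₁ = g₁(· + (log p)/2) + sign b · g₁(· − (log p)/2)` has parity
`sign b` — even for `b > 0`, odd for `b < 0` — so THEOREM F3-A's certified-negative direction lies in the
parity-`sign b` block.  (Which block fails FIRST is DATA; the theorem only places the F3-A witness.)
-/

set_option linter.dupNamespace false

noncomputable section

open MeasureTheory Set Filter Complex
open scoped Real Topology

namespace Summit.RiemannHypothesis.RiemannHypothesis.Theorems.PfPersistenceBarrier

open Literature.NumberTheory.LFunctions ExplicitDatum

/-- Reflection of the F3-A twin of an even test: `T(-x) = sign b · T(x)` (`b ≠ 0`). [folklore] -/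
theorem sharpTwinTest_neg_apply (p : ℕ) {b : ℝ} (hb : b ≠ 0) {g₁ : ℝ → ℂ}
    (hg : ∀ x, g₁ (-x) = g₁ x) (x : ℝ) :
    sharpTwinTest p b g₁ (-x) = ((SignType.sign b : ℝ) : ℂ) * sharpTwinTest p b g₁ x := by
  have hs : (SignType.sign b : ℝ) * (SignType.sign b : ℝ) = 1 := by
    rcases lt_or_gt_of_ne hb with h | h
    · rw [sign_neg h]; simp
    · rw [sign_pos h]; simp
  have h1 : g₁ (-x + Real.log p / 2) = g₁ (x - Real.log p / 2) := by
    rw [show -x + Real.log p / 2 = -(x - Real.log p / 2) by ring, hg]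
  have h2 : g₁ (-x - Real.log p / 2) = g₁ (x + Real.log p / 2) := by
    rw [show -x - Real.log p / 2 = -(x + Real.log p / 2) by ring, hg]
  simp only [sharpTwinTest, h1, h2]
  have hs' : ((SignType.sign b : ℝ) : ℂ) * ((SignType.sign b : ℝ) : ℂ) = 1 := by
    rw [← Complex.ofReal_mul, hs, Complex.ofReal_one]
  linear_combination (-(g₁ (x - Real.log p / 2))) * hs'

/-- `b > 0`: the F3-A twin of an even test is EVEN. [folklore] -/
theorem sharpTwinTest_even_of_pos (p : ℕ) {b : ℝ} (hb : 0 < b) {g₁ : ℝ → ℂ}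
    (hg : ∀ x, g₁ (-x) = g₁ x) (x : ℝ) :
    sharpTwinTest p b g₁ (-x) = sharpTwinTest p b g₁ x := by
  rw [sharpTwinTest_neg_apply p hb.ne' hg, sign_pos hb]; simp

/-- `b < 0`: the F3-A twin of an even test is ODD. [folklore] -/
theorem sharpTwinTest_odd_of_neg (p : ℕ) {b : ℝ} (hb : b < 0) {g₁ : ℝ → ℂ}
    (hg : ∀ x, g₁ (-x) = g₁ x) (x : ℝ) :
    sharpTwinTest p b g₁ (-x) = -sharpTwinTest p b g₁ x := by
  rw [sharpTwinTest_neg_apply p hb.ne hg, sign_neg hb]; simp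

end Summit.RiemannHypothesis.RiemannHypothesis.Theorems.PfPersistenceBarrier
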